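import Literature.MathematicalPhysics.PowerSystems.RingTwistedStateInstability
import HarnessLib

/-!
# The census of normal-operation synchronous states of the homogeneous unloaded ring: they are
# exactly the `q`-twisted states with `4|q| < N`, so the ring `R_N` carries EXACTLY `2⌈N/4⌉ − 1` of
# them per period (Manik–Timme–Witthaut 2017, Thm 12 for `P ≡ 0`; Cor. 4), every one STABLE

Topic `Literature/MathematicalPhysics/PowerSystems`, namespace
`Literature.MathematicalPhysics.PowerSystems.ClassicalModel`. Companion of `RingMultistability.lean`
(gridfusion-lit-1: `ringSystem`, `twistedState`, `twistedState_stable`, `ring_multistable` — the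
twisted states with `4|q| < N` are STABLE synchronous states) and `RingTwistedStateInstability.lean`
(those with `cos(2πq/N) < 0` are unstable). Here the CENSUS: every synchronous state of the unloaded
ring in normal operation IS a twisted state modulo `2π` per machine, which turns the printed count of
Thm 12 into a kernel theorem for `P ≡ 0`. Everything below is PROVED (no definition, no named fact,
no new axiom).

SOURCES (read on the page this session).

* D. Manik, M. Timme, D. Witthaut, *Cycle flows and multistability in oscillatory networks*, Chaos
  27 (2017) 083123 [ManikTimmeWitthaut2017] (`lit read arxiv:1611.09825`, chunks p0004, p0012,
  p0013). §3 **Cor. 1** (p0004 L68–L77, normal operation ⇒ stable). §5.4 *Simple cycles* (p0012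
  L25–L33): «For networks containing a single cycle, tight upper and lower bounds can be obtained for
  the number of fixed points satisfying cos(θ*ᵢ − θ*ⱼ) > 0 for all edges (i,j). These states
  correspond to the normal operation of a power grid and are guaranteed to be stable by corollary 1».
  **Theorem 12** (p0012 L62–L75): «For a ring network R_N, the number of normal operation fixed point
  (denoted by 𝒩) is given by 𝒩 = ⌈(1/2π)Σⱼ arcsin((F⁰_{j+1,j} + f^max_c)/K_{j+1,j})⌉
  − ⌊(1/2π)Σⱼ arcsin((F⁰_{j+1,j} + f^min_c)/K_{j+1,j})⌋ − 1», proof p0012 L80–L120 (all flows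
  `F = F⁰ + f_c`; in normal operation `Δⱼ = arcsin(Fⱼ/Kⱼ)`; winding number
  `ϖ(f_c) = (1/2π)Σ arcsin ∈ ℤ`; «the distinct fixed points correspond to the following values of
  the winding number»). **Cor. 4** (p0013 L121–132): «In particular, ring networks R_N with N ≤ 4
  do not have multiple stable fixed points». For the UNLOADED homogeneous ring (`P ≡ 0`, `F⁰ = 0`,
  `f^max_c = K = −f^min_c`) Thm 12 reads `𝒩 = ⌈N/4⌉ − ⌊−N/4⌋ − 1 = 2⌈N/4⌉ − 1`.
* A. Mihara, M. Zaks, E. E. N. Macau, R. O. Medrano-T, Phys. Rev. E 105 (2022) L052202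
  [MiharaEtAl2022] (arXiv:2112.10040 p0005 L50–L70): the `q`-twisted states `Δⱼ = θⱼ − θⱼ₋₁ = 2πq/N`
  («Recalling that Δⱼ is taken mod 2π …»), winding numbers `q = −m, …, m`.

## What is proved (ring of `N = n + 1 ≥ 3` machines, `ρ = finRotate (n+1)` the cyclic neighbour)

* §1 `ringSystem_flow_eq` (the nodal flow of ANY angle vector: `K sin(θₖ − θ_{ρk}) + K sin(θₖ − θ_{ρ⁻¹k})`),
  `ring_sin_edge_eq_of_flow_eq_zero` (at a synchronous state of the unloaded ring ALL edge sines
  `sin(θₖ − θ_{ρk})` are equal — Kirchhoff on a cycle: the edge flows are one cycle flow `f_c`),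
  `exists_eq_add_int_mul_two_pi_of_sin_eq_of_cos_pos` (trigonometric plumbing: equal sines and
  positive cosines ⇒ equal angles mod `2π` — the printed «Δⱼ = arcsin(Fⱼ/Kⱼ)» in normal operation).
* §2 **`exists_winding_of_normalOperation`** — every synchronous state of the unloaded ring with
  `cos(θₖ − θ_{ρk}) > 0` on every edge is a TWISTED STATE modulo `2π` per machine:
  `∃ q ∈ ℤ, 4|q| < N, ∀ j ∃ mⱼ ∈ ℤ, θⱼ = θ₀ + 2πq·j/N + 2πmⱼ` (summing the edge angles `α + 2πmₖ`
  around the cycle gives `Nα ∈ 2πℤ`, the winding number; `|α| < π/2` gives `4|q| < N`).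
* §3 THE CENSUS of the pinned period box `{θ₀ = 0, θᵢ ∈ [−π, π)}`:
  `twistedBox_mem` (the box representative of `θ_q`, `4|q| < N`, is a pinned normal-operation
  synchronous state), `eq_twistedBox_of_mem` (every pinned normal-operation synchronous state of the
  box is one of them), `twistedBox_injOn` (distinct `q` with `4|q| < N` give distinct states), and
  ★ **`ncard_ring_normalOperation_syncStates`**: the pinned normal-operation synchronous states of the
  box number EXACTLY `2⌊n/4⌋ + 1 = 2⌈N/4⌉ − 1` (Thm 12 for `P ≡ 0`; e.g. `N ≤ 4 ⇒ 1`, `N = 5,…,8 ⇒ 3`,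
  `N = 9,…,12 ⇒ 5`).
* §4 ★★ **`ring_normalOperation_census`** — the count together with COR. 1 for each of them: every one
  of the `2⌈N/4⌉ − 1` states is a STABLE synchronous state of the damped swing model on the ring
  (`stable_syncSolution_of_normalOperation`: motions from nearby states stay nearby and converge to the
  rotated rest point of their own momentum leaf) — «these states … are guaranteed to be stable»; and
  `ring_no_multistability_of_le_four` (Cor. 4: `N ≤ 4` ⇒ exactly ONE, the in-phase state).

DEVIATIONS FROM THE PRINTED PROOF. Thm 12 is printed for arbitrary injections through a particular
flow solution `F⁰` and the winding-number function `ϖ(f_c)`; here only the unloaded homogeneous ring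
(`F⁰ = 0`, where `ϖ(f_c) = (N/2π)arcsin(f_c/K)` and the admissible winding numbers are the integers
`q` with `4|q| < N`) — the case of Cor. 4's «homogeneous rings» with `P̄ = 0` — is typed, with the
fixed points counted as pinned representatives in the half-open period box (one per torus point modulo
rotation, the tree's convention of `RadialNetwork.ncard_pinned_equilibria_eq`). The loaded ring
(general `F⁰`) is NOT typed here. Stability is the energy-route Cor. 1 of `NormalOperationStability`
(nonlinear, census-free), not the spectral Lemma 1.

THREE COLUMNS (LADDER-GRIDFUSION honest framing). CERTIFIED for MODEL `M` = damped lossless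
network-reduced swing model on the homogeneous unloaded ring (`P = 0`, uniform `K > 0`, `Mᵢ, Dᵢ > 0`;
MODEL-VALIDITY MV-1 class — an idealised ring, not a grid record): the exact number of
normal-operation synchronous states per period and the stability of each. NOT CLAIMED: states outside
normal operation (the twisted states with `N < 4|q|`, `2|q| ≤ N` are unstable,
`RingTwistedStateInstability`; the borderline `4|q| = N` is neither counted nor classified here); basin sizes; loaded or inhomogeneous rings; anything about a physical system.
-/

noncomputable section

open Real Set Filter Topology Metric Finset

namespace Literature.MathematicalPhysics.PowerSystems

namespace ClassicalModel

section Ring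

variable {n : ℕ} (K : ℝ) (M D : Fin (n + 1) → ℝ)

/-! ### §1. Kirchhoff on a cycle: at a synchronous state of the unloaded ring all edge sines agree -/

/-- On a ring of at least three machines the two neighbours `ρ k` and `ρ⁻¹ k` of a node are
different (private plumbing; the same fact is private in `RingMultistability`). [folklore] -/
private theorem rotate_ne_rotate_symm' (hn : 2 ≤ n) (k : Fin (n + 1)) :
    finRotate (n + 1) k ≠ (finRotate (n + 1)).symm k := by
  intro h
  set j := (finRotate (n + 1)).symm k with hj
  have hk : finRotate (n + 1) j = k := by simp [hj]
  have h2 : finRotate (n + 1) (finRotate (n + 1) j) = j := by rw [hk]; exact h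
  have hv1 : (finRotate (n + 1) j).val = if j = Fin.last n then 0 else j.val + 1 := coe_finRotate j
  have hv2 : (finRotate (n + 1) (finRotate (n + 1) j)).val
      = if finRotate (n + 1) j = Fin.last n then 0 else (finRotate (n + 1) j).val + 1 :=
    coe_finRotate _
  rw [h2] at hv2
  have hjlt : j.val < n + 1 := j.isLt
  by_cases hl : j = Fin.last n
  · have hjn : j.val = n := by rw [hl, Fin.val_last]
    rw [if_pos hl] at hv1
    have hne : finRotate (n + 1) j ≠ Fin.last n := by
      intro h'
      have h'' := congrArg Fin.val h'
      rw [hv1, Fin.val_last] at h''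
      omega
    rw [if_neg hne, hv1] at hv2
    omega
  · rw [if_neg hl] at hv1
    have hjn : j.val ≠ n := fun h' => hl (Fin.ext (by rw [h', Fin.val_last]))
    by_cases hl2 : finRotate (n + 1) j = Fin.last n
    · have h'' := congrArg Fin.val hl2
      rw [hv1, Fin.val_last] at h''
      rw [if_pos hl2] at hv2
      omega
    · rw [if_neg hl2, hv1] at hv2
      omega

/-- **The nodal flow of the homogeneous ring at ANY angle vector** (at least three machines): at node
`k` only the two ring edges contribute, `flowₖ(θ) = K sin(θₖ − θ_{ρk}) + K sin(θₖ − θ_{ρ⁻¹k})`.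
[cite: ManikTimmeWitthaut2017, §5.4 («We label the nodes as 1,2,…,N along the cycle …») and §2 eq. (dynamic condition); MiharaEtAl2022, §I eq. (1) (nearest-neighbour ring, R = 1)] -/
theorem ringSystem_flow_eq (hn : 2 ≤ n) (θ : Fin (n + 1) → ℝ) (k : Fin (n + 1)) :
    (ringSystem n K M D).flow θ k
      = K * Real.sin (θ k - θ (finRotate (n + 1) k))
        + K * Real.sin (θ k - θ ((finRotate (n + 1)).symm k)) := by
  have hab : finRotate (n + 1) k ≠ (finRotate (n + 1)).symm k := rotate_ne_rotate_symm' hn k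
  have hflow : (ringSystem n K M D).flow θ k
      = ∑ j, (if j = finRotate (n + 1) k ∨ k = finRotate (n + 1) j then K else 0)
          * Real.sin (θ k - θ j) := by
    simp [LosslessSystem.flow, ringSystem]
  have hrow : ∀ j, (if j = finRotate (n + 1) k ∨ k = finRotate (n + 1) j then K else 0)
      = (if j = finRotate (n + 1) k then K else 0)
        + (if j = (finRotate (n + 1)).symm k then K else 0) := by
    intro j
    have hiff : (k = finRotate (n + 1) j) ↔ (j = (finRotate (n + 1)).symm k) := by
      rw [Equiv.eq_symm_apply]
      exact eq_comm
    simp only [hiff]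
    by_cases h1 : j = finRotate (n + 1) k
    · have h2 : j ≠ (finRotate (n + 1)).symm k := fun h => hab (h1.symm.trans h)
      rw [if_pos (Or.inl h1), if_pos h1, if_neg h2, add_zero]
    · by_cases h2 : j = (finRotate (n + 1)).symm k
      · rw [if_pos (Or.inr h2), if_neg h1, if_pos h2, zero_add]
      · rw [if_neg (not_or.2 ⟨h1, h2⟩), if_neg h1, if_neg h2, add_zero]
  rw [hflow]
  simp only [hrow, add_mul, Finset.sum_add_distrib, ite_mul, zero_mul, Finset.sum_ite_eq',
    Finset.mem_univ, if_true]

/-- **Kirchhoff on a cycle: at a synchronous state of the UNLOADED ring all edge sines are equal**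
(`K ≠ 0`, at least three machines): `flowₖ(θ) = 0` at every node forces
`sin(θₖ − θ_{ρk}) = sin(θ₀ − θ_{ρ0})` for every `k` (the flow entering a node equals the flow leaving
it, and walking around the cycle from node `0` reaches every node) — the printed «all flows
`F = F⁰ + f_c`» with `F⁰ = 0`: one cycle flow `f_c = −K·sin(θ₀ − θ_{ρ0})` on every edge.
[cite: ManikTimmeWitthaut2017, §5.4 proof of Thm 12 («analyze … which cycle flow values f_c lead to different valid fixed points») and Remark 11 (cycle flow f_c)] -/
theorem ring_sin_edge_eq_of_flow_eq_zero (hn : 2 ≤ n) (hK : K ≠ 0) {θ : Fin (n + 1) → ℝ}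
    (hθ : ∀ k, (ringSystem n K M D).flow θ k = 0) :
    ∀ k, Real.sin (θ k - θ (finRotate (n + 1) k))
      = Real.sin (θ 0 - θ (finRotate (n + 1) 0)) := by
  -- the sine of the edge leaving `ρ j` equals the sine of the edge leaving `j`
  have hstep : ∀ j, Real.sin (θ (finRotate (n + 1) j) - θ (finRotate (n + 1) (finRotate (n + 1) j)))
      = Real.sin (θ j - θ (finRotate (n + 1) j)) := by
    intro j
    have h := hθ (finRotate (n + 1) j)
    rw [ringSystem_flow_eq K M D hn θ, Equiv.symm_apply_apply] at h
    have hs : Real.sin (θ (finRotate (n + 1) j) - θ j) = -Real.sin (θ j - θ (finRotate (n + 1) j)) := by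
      rw [← Real.sin_neg, neg_sub]
    rw [hs] at h
    have h2 : K * (Real.sin (θ (finRotate (n + 1) j) - θ (finRotate (n + 1) (finRotate (n + 1) j)))
        - Real.sin (θ j - θ (finRotate (n + 1) j))) = 0 := by
      have : K * Real.sin (θ (finRotate (n + 1) j) - θ (finRotate (n + 1) (finRotate (n + 1) j)))
          + K * -Real.sin (θ j - θ (finRotate (n + 1) j)) = 0 := h
      linarith
    rcases mul_eq_zero.1 h2 with h3 | h3
    · exact absurd h3 hK
    · linarith
  -- iterate the rotation from node `0`: every node is reached
  have hiter : ∀ m : ℕ, Real.sin (θ ((finRotate (n + 1))^[m] 0)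
      - θ (finRotate (n + 1) ((finRotate (n + 1))^[m] 0)))
      = Real.sin (θ 0 - θ (finRotate (n + 1) 0)) := by
    intro m
    induction m with
    | zero => simp
    | succ m ih => rw [Function.iterate_succ_apply', hstep, ih]
  intro k
  have e : (finRotate (n + 1))^[(k - 0).val] 0 = k := by
    rw [← finCycle_eq_finRotate_iterate, finCycle_apply, add_sub_cancel]
  have h := hiter (k - 0).val
  rw [e] at h
  exact h

/-- Trigonometric plumbing for «Δⱼ = arcsin(Fⱼ/Kⱼ) in normal operation»: two angles with the same
sine and POSITIVE cosines differ by a whole number of turns. [folklore] [cite: ManikTimmeWitthaut2017, §5.4 proof of Thm 12 («Since we restrict ourselves to normal operation, the winding number for a single cycle reads ϖ(f_c) = (1/2π)Σⱼ arcsin(…)»)] -/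
theorem exists_eq_add_int_mul_two_pi_of_sin_eq_of_cos_pos {x a : ℝ} (hs : Real.sin x = Real.sin a)
    (hx : 0 < Real.cos x) (ha : 0 < Real.cos a) : ∃ m : ℤ, x = a + m * (2 * π) := by
  obtain ⟨m, h | h⟩ := Real.sin_eq_sin_iff.1 hs.symm
  · exact ⟨m, by rw [h]; ring⟩
  · exfalso
    have hc : Real.cos x = -Real.cos a := by
      rw [h, show (2 * (m : ℝ) + 1) * π - a = (π - a) + (m : ℝ) * (2 * π) by ring,
        Real.cos_add_int_mul_two_pi, Real.cos_pi_sub]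
    linarith

/-! ### §2. Every normal-operation synchronous state of the unloaded ring is a twisted state modulo
`2π` per machine, with winding number `4|q| < N` -/

/-- **The winding number of a normal-operation synchronous state** (`N = n + 1 ≥ 3` machines,
`K > 0`): if `flowₖ(θ) = 0` at every node and `cos(θₖ − θ_{ρk}) > 0` on every ring edge, then there is
an integer `q` with `4|q| < N` such that for every machine `j`,
`θⱼ = θ₀ + 2πq·j/N + 2πmⱼ` for some integer `mⱼ` — i.e. `θ` IS the `q`-twisted state up to a rotation
and whole turns of single machines. PROOF (the printed one with `F⁰ = 0`): all edge sines are equal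
(§1), so with positive cosines every edge angle is `α + 2πmₖ`, `α = arcsin(f_c/K) ∈ (−π/2, π/2)`;
summing around the cycle gives `Nα = −2πΣₖmₖ = −2πq` (the printed winding condition `ϖ ∈ ℤ`),
and `|α| < π/2` is `4|q| < N`; walking from node `0` along the cycle gives the formula.
[cite: ManikTimmeWitthaut2017, §5.4 Thm 12 and its proof (p0012 L80–L120); MiharaEtAl2022, §I (q-twisted states, «Recalling that Δⱼ is taken mod 2π»)] -/
theorem exists_winding_of_normalOperation (hn : 2 ≤ n) (hK : 0 < K) {θ : Fin (n + 1) → ℝ}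
    (hθ : ∀ k, (ringSystem n K M D).flow θ k = 0)
    (hno : ∀ k, 0 < Real.cos (θ k - θ (finRotate (n + 1) k))) :
    ∃ q : ℤ, 4 * |q| < (n : ℤ) + 1 ∧ ∀ j : Fin (n + 1), ∃ mj : ℤ,
      θ j = θ 0 + twistedState n q j + mj * (2 * π) := by
  have hN : (0 : ℝ) < (n : ℝ) + 1 := by positivity
  have hπ := Real.pi_pos
  set s := Real.sin (θ 0 - θ (finRotate (n + 1) 0)) with hs
  have hsin : ∀ k, Real.sin (θ k - θ (finRotate (n + 1) k)) = s :=
    ring_sin_edge_eq_of_flow_eq_zero K M D hn hK.ne' hθ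
  -- `|s| < 1`, hence `α = arcsin s` has `sin α = s`, `cos α > 0`, `|α| < π/2`
  have hc0 : 0 < Real.cos (θ 0 - θ (finRotate (n + 1) 0)) := hno 0
  have hs1 : s ^ 2 < 1 := by
    have h := Real.sin_sq_add_cos_sq (θ 0 - θ (finRotate (n + 1) 0))
    nlinarith [hc0]
  have hsabs : |s| < 1 := (sq_lt_one_iff_abs_lt_one s).1 hs1
  have hslt : s < 1 := (abs_lt.1 hsabs).2
  have hsgt : -1 < s := (abs_lt.1 hsabs).1
  set α := Real.arcsin s with hα
  have hsinα : Real.sin α = s := Real.sin_arcsin hsgt.le hslt.le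
  have hcosα : 0 < Real.cos α := by
    rw [hα, Real.cos_arcsin]
    exact Real.sqrt_pos.2 (by nlinarith)
  have hαlt : α < π / 2 := Real.arcsin_lt_pi_div_two.2 hslt
  have hαgt : -(π / 2) < α := Real.neg_pi_div_two_lt_arcsin.2 hsgt
  -- every edge angle is `α` up to whole turns
  have hedge : ∀ k, ∃ mk : ℤ, θ k - θ (finRotate (n + 1) k) = α + mk * (2 * π) := fun k =>
    exists_eq_add_int_mul_two_pi_of_sin_eq_of_cos_pos (by rw [hsin k, hsinα]) (hno k) hcosα
  choose mk hmk using hedge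
  -- summing around the cycle: `(n+1)α + 2πΣmk = 0`
  have hsum0 : ∑ k, (θ k - θ (finRotate (n + 1) k)) = 0 := by
    rw [Finset.sum_sub_distrib, Equiv.sum_comp (finRotate (n + 1)) θ, sub_self]
  have hsum : ((n : ℝ) + 1) * α + (∑ k, (mk k : ℝ)) * (2 * π) = 0 := by
    have h1 : ∑ k, (θ k - θ (finRotate (n + 1) k)) = ∑ k, (α + (mk k : ℝ) * (2 * π)) :=
      Finset.sum_congr rfl fun k _ => hmk k
    rw [hsum0, Finset.sum_add_distrib, Finset.sum_const, Finset.card_univ, Fintype.card_fin,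
      nsmul_eq_mul, ← Finset.sum_mul] at h1
    push_cast at h1
    linarith
  set q : ℤ := ∑ k, mk k with hq
  have hqR : (q : ℝ) = ∑ k, (mk k : ℝ) := by rw [hq]; push_cast; rfl
  have hα' : α = -(2 * π * (q : ℝ) / (n + 1)) := by
    rw [hqR]
    field_simp
    linarith
  -- `|α| < π/2` is `4|q| < N`
  have hq4 : 4 * |q| < (n : ℤ) + 1 := by
    have h1 : |α| < π / 2 := abs_lt.2 ⟨hαgt, hαlt⟩
    rw [hα', abs_neg, abs_div, abs_mul, abs_of_pos (by positivity : (0 : ℝ) < 2 * π),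
      abs_of_pos hN, div_lt_iff₀ hN] at h1
    have h2 : 4 * |(q : ℝ)| < (n : ℝ) + 1 := by nlinarith
    exact_mod_cast h2
  refine ⟨q, hq4, ?_⟩
  -- walking from node `0`: `θ(ρ^i 0) = θ 0 + 2πq·i/N + 2πMᵢ`
  have hstepθ : ∀ k, θ (finRotate (n + 1) k) = θ k + 2 * π * (q : ℝ) / (n + 1) - (mk k : ℝ) * (2 * π) := by
    intro k
    have h := hmk k
    rw [hα'] at h
    linarith
  have hiter : ∀ i : ℕ, ∃ Mi : ℤ, θ ((finRotate (n + 1))^[i] 0)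
      = θ 0 + 2 * π * (q : ℝ) * (i : ℝ) / (n + 1) + (Mi : ℝ) * (2 * π) := by
    intro i
    induction i with
    | zero => exact ⟨0, by simp⟩
    | succ i ih =>
      obtain ⟨Mi, hMi⟩ := ih
      refine ⟨Mi - mk ((finRotate (n + 1))^[i] 0), ?_⟩
      rw [Function.iterate_succ_apply', hstepθ, hMi]
      push_cast
      ring
  intro j
  obtain ⟨Mj, hMj⟩ := hiter (j - 0).val
  have e : (finRotate (n + 1))^[(j - 0).val] 0 = j := by
    rw [← finCycle_eq_finRotate_iterate, finCycle_apply, add_sub_cancel]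
  rw [e, sub_zero] at hMj
  refine ⟨Mj, ?_⟩
  rw [hMj]
  simp only [twistedState]

/-! ### §3. THE CENSUS of the pinned period box: exactly `2⌊n/4⌋ + 1 = 2⌈N/4⌉ − 1` normal-operation
synchronous states -/

/-- The winding-number window as a finite integer interval: `4|q| < n + 1 ⇔ −⌊n/4⌋ ≤ q ≤ ⌊n/4⌋`.
[cite: ManikTimmeWitthaut2017, §5.4 proof of Thm 12 («the distinct fixed points correspond to the following values of the winding number …»)] -/
theorem mem_windingWindow_iff (q : ℤ) :
    q ∈ Finset.Icc (-((n / 4 : ℕ) : ℤ)) ((n / 4 : ℕ) : ℤ) ↔ 4 * |q| < (n : ℤ) + 1 := by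
  rw [Finset.mem_Icc]
  rcases le_or_gt 0 q with h | h
  · rw [abs_of_nonneg h]; omega
  · rw [abs_of_neg h]; omega

/-- The window has `2⌊n/4⌋ + 1` integers (`= ⌈N/4⌉ − ⌊−N/4⌋ − 1 = 2⌈N/4⌉ − 1` for `N = n + 1`:
the printed count of Thm 12 with `F⁰ = 0`, `f^max_c = K = −f^min_c`).
[cite: ManikTimmeWitthaut2017, §5.4 Thm 12 (the ceiling/floor count)] -/
theorem card_windingWindow :
    (Finset.Icc (-((n / 4 : ℕ) : ℤ)) ((n / 4 : ℕ) : ℤ)).card = 2 * (n / 4) + 1 := by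
  rw [Int.card_Icc]
  omega

/-- `4|q| < N` ⇒ `cos(2πq/N) > 0` (the twisted state's residual capacity is positive).
[cite: MiharaEtAl2022, §I eq. (4) (R = 1: cos(2πq/N)); ManikTimmeWitthaut2017, §3 Cor. 1] -/
theorem cos_twisted_pos {q : ℤ} (hq : 4 * |q| < (n : ℤ) + 1) :
    0 < Real.cos (2 * π * q / (n + 1)) := by
  have hN : (0 : ℝ) < (n : ℝ) + 1 := by positivity
  have hq' : 4 * |(q : ℝ)| < (n : ℝ) + 1 := by exact_mod_cast hq
  have hπ := Real.pi_pos
  have hb : |2 * π * q / (n + 1)| < π / 2 := by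
    rw [abs_div, abs_of_pos hN, div_lt_iff₀ hN, abs_mul,
      abs_of_pos (by positivity : (0:ℝ) < 2 * π)]
    nlinarith
  exact Real.cos_pos_of_mem_Ioo ⟨by linarith [neg_abs_le (2 * π * q / (n + 1))],
    by linarith [le_abs_self (2 * π * q / (n + 1))]⟩

/-- The box representative of the `q`-twisted state is the twisted state plus whole turns of single
machines. [folklore] [cite: MiharaEtAl2022, §I («Recalling that Δⱼ is taken mod 2π»)] -/
theorem twistedBox_eq_add (q : ℤ) :
    (fun j : Fin (n + 1) => toIcoMod Real.two_pi_pos (-π) (twistedState n q j))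
      = fun j => twistedState n q j
        + 2 * π * ((-toIcoDiv Real.two_pi_pos (-π) (twistedState n q j) : ℤ) : ℝ) := by
  funext j
  have h := toIcoMod_add_toIcoDiv_zsmul Real.two_pi_pos (-π) (twistedState n q j)
  rw [zsmul_eq_mul] at h
  push_cast
  linarith

/-- **The box representatives of the twisted states with `4|q| < N` are pinned normal-operation
synchronous states of the box** (`N ≥ 3`): pinned at machine `0`, all angles in `[−π, π)`, every
nodal flow zero (flows are `2π`-periodic per machine), every ring-edge cosine `cos(2πq/N) > 0`.
[cite: ManikTimmeWitthaut2017, §5.4 («These states correspond to the normal operation of a power grid») and Thm 12; MiharaEtAl2022, §I] -/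
theorem twistedBox_mem (hn : 2 ≤ n) {q : ℤ} (hq : 4 * |q| < (n : ℤ) + 1) :
    (fun j : Fin (n + 1) => toIcoMod Real.two_pi_pos (-π) (twistedState n q j)) ∈
      {θ : Fin (n + 1) → ℝ | θ 0 = 0 ∧ (∀ i, θ i ∈ Set.Ico (-π) π) ∧
        (∀ k, (ringSystem n K M D).flow θ k = 0) ∧
        ∀ k, 0 < Real.cos (θ k - θ (finRotate (n + 1) k))} := by
  have hπ := Real.pi_pos
  have hIco : ∀ x : ℝ, toIcoMod Real.two_pi_pos (-π) x ∈ Set.Ico (-π) π := by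
    intro x
    have h := toIcoMod_mem_Ico Real.two_pi_pos (-π) x
    rwa [show -π + 2 * π = π by ring] at h
  refine ⟨?_, fun i => hIco _, ?_, ?_⟩
  · -- pinned: `θ_q 0 = 0 ∈ [−π, π)`
    have h0 : twistedState n q 0 = 0 := by simp [twistedState]
    show toIcoMod Real.two_pi_pos (-π) (twistedState n q 0) = 0
    rw [h0, toIcoMod_eq_self]
    constructor <;> linarith
  · intro k
    rw [twistedBox_eq_add, (ringSystem n K M D).flow_add_int_mul_two_pi,
      ringSystem_flow_twistedState K M D q hn]
  · intro k
    rw [twistedBox_eq_add]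
    have e : twistedState n q k
        + 2 * π * ((-toIcoDiv Real.two_pi_pos (-π) (twistedState n q k) : ℤ) : ℝ)
        - (twistedState n q (finRotate (n + 1) k)
          + 2 * π * ((-toIcoDiv Real.two_pi_pos (-π) (twistedState n q (finRotate (n + 1) k)) : ℤ) : ℝ))
        = (twistedState n q k - twistedState n q (finRotate (n + 1) k))
          + ((-toIcoDiv Real.two_pi_pos (-π) (twistedState n q k)
              - -toIcoDiv Real.two_pi_pos (-π) (twistedState n q (finRotate (n + 1) k)) : ℤ) : ℝ)
            * (2 * π) := by
      push_cast
      ring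
    rw [e, Real.cos_add_int_mul_two_pi, cos_twisted_edge]
    exact cos_twisted_pos hq

/-- **Every pinned normal-operation synchronous state of the box IS the box representative of a
twisted state with `4|q| < N`** (`N ≥ 3`, `K > 0`): by `exists_winding_of_normalOperation` and
uniqueness of the representative in `[−π, π)`.
[cite: ManikTimmeWitthaut2017, §5.4 Thm 12 proof («As the winding numbers are unique …, the distinct fixed points correspond to the following values of the winding number»)] -/
theorem eq_twistedBox_of_mem (hn : 2 ≤ n) (hK : 0 < K) {θ : Fin (n + 1) → ℝ}
    (hθ : θ ∈ {θ : Fin (n + 1) → ℝ | θ 0 = 0 ∧ (∀ i, θ i ∈ Set.Ico (-π) π) ∧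
        (∀ k, (ringSystem n K M D).flow θ k = 0) ∧
        ∀ k, 0 < Real.cos (θ k - θ (finRotate (n + 1) k))}) :
    ∃ q : ℤ, 4 * |q| < (n : ℤ) + 1 ∧
      θ = fun j => toIcoMod Real.two_pi_pos (-π) (twistedState n q j) := by
  obtain ⟨h0, hbox, hflow, hno⟩ := hθ
  obtain ⟨q, hq, hj⟩ := exists_winding_of_normalOperation K M D hn hK hflow hno
  refine ⟨q, hq, funext fun j => ?_⟩
  obtain ⟨mj, hmj⟩ := hj j
  rw [h0, zero_add] at hmj
  symm
  rw [toIcoMod_eq_iff]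
  refine ⟨by rw [show -π + 2 * π = π by ring]; exact hbox j, -mj, ?_⟩
  rw [hmj, zsmul_eq_mul]
  push_cast
  ring

/-- **Different winding numbers in the window give different box states** (`N ≥ 2`): the machine-`1`
angles `2πq/N` and `2πq′/N` agree modulo `2π` only if `N ∣ (q − q′)`, impossible for
`0 < |q − q′| < N/2`. [cite: ManikTimmeWitthaut2017, §5.4 («the distinct fixed points correspond to the … values of the winding number»); MiharaEtAl2022, §I (range q = −m, …, m)] -/
theorem twistedBox_injOn (hn : 1 ≤ n) :
    Set.InjOn (fun q : ℤ => fun j : Fin (n + 1) => toIcoMod Real.two_pi_pos (-π) (twistedState n q j))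
      {q : ℤ | 4 * |q| < (n : ℤ) + 1} := by
  intro q hq q' hq' h
  have hq1 : 4 * |q| < (n : ℤ) + 1 := hq
  have hq2 : 4 * |q'| < (n : ℤ) + 1 := hq'
  have hN : (0 : ℝ) < (n : ℝ) + 1 := by positivity
  have hπ := Real.pi_pos
  set j₁ : Fin (n + 1) := ⟨1, by omega⟩ with hj₁
  have h1 := congrFun h j₁
  simp only at h1
  rw [toIcoMod_eq_toIcoMod] at h1
  obtain ⟨z, hz⟩ := h1
  have hv : (j₁.val : ℝ) = 1 := by simp [hj₁]
  simp only [twistedState, hv, mul_one, zsmul_eq_mul] at hz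
  -- `2π q'/N − 2π q/N = z·2π` ⇒ `q' − q = z(n+1)`
  have hzq : ((q' : ℝ) - q) = z * ((n : ℝ) + 1) := by
    field_simp at hz
    nlinarith [hz]
  have hzq' : q' - q = z * ((n : ℤ) + 1) := by exact_mod_cast hzq
  -- `|q' − q| < n + 1` forces `z = 0`
  have hz0 : z = 0 := by
    rcases le_or_gt 0 q with h₁ | h₁ <;> rcases le_or_gt 0 q' with h₂ | h₂ <;>
      rcases le_or_gt 0 z with h₃ | h₃
    all_goals
      first
      | (rw [abs_of_nonneg h₁] at hq1; rw [abs_of_nonneg h₂] at hq2; nlinarith)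
      | (rw [abs_of_nonneg h₁] at hq1; rw [abs_of_neg h₂] at hq2; nlinarith)
      | (rw [abs_of_neg h₁] at hq1; rw [abs_of_nonneg h₂] at hq2; nlinarith)
      | (rw [abs_of_neg h₁] at hq1; rw [abs_of_neg h₂] at hq2; nlinarith)
  rw [hz0, zero_mul, sub_eq_zero] at hzq'
  exact hzq'.symm

/-- ★ **THEOREM 12 FOR THE UNLOADED RING: the homogeneous unloaded ring of `N = n + 1 ≥ 3` machines
(`K > 0`) carries EXACTLY `2⌊n/4⌋ + 1 = 2⌈N/4⌉ − 1` normal-operation synchronous states per period**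
— counted as the synchronous states (`flow = P − Dω_s = 0`) pinned at machine `0` with all angles in
`[−π, π)` and positive cosine on every ring edge: they are precisely the box representatives of the
`q`-twisted states with `4|q| < N` (`twistedBox_mem`, `eq_twistedBox_of_mem`, `twistedBox_injOn`).
E.g. `N ≤ 4`: one (Cor. 4); `N = 5,…,8`: three; `N = 9,…,12`: five.
[cite: ManikTimmeWitthaut2017, §5.4 Thm 12 («the number of normal operation fixed point 𝒩 = ⌈…⌉ − ⌊…⌋ − 1») and Cor. 4; MiharaEtAl2022, §I (q-twisted states, winding numbers q = −m, …, m)] -/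
theorem ncard_ring_normalOperation_syncStates (hn : 2 ≤ n) (hK : 0 < K) :
    {θ : Fin (n + 1) → ℝ | θ 0 = 0 ∧ (∀ i, θ i ∈ Set.Ico (-π) π) ∧
        (∀ k, (ringSystem n K M D).flow θ k = 0) ∧
        ∀ k, 0 < Real.cos (θ k - θ (finRotate (n + 1) k))}.ncard = 2 * (n / 4) + 1 := by
  have himage : {θ : Fin (n + 1) → ℝ | θ 0 = 0 ∧ (∀ i, θ i ∈ Set.Ico (-π) π) ∧
        (∀ k, (ringSystem n K M D).flow θ k = 0) ∧
        ∀ k, 0 < Real.cos (θ k - θ (finRotate (n + 1) k))}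
      = (fun q : ℤ => fun j : Fin (n + 1) => toIcoMod Real.two_pi_pos (-π) (twistedState n q j))
          '' {q : ℤ | 4 * |q| < (n : ℤ) + 1} := by
    ext θ
    constructor
    · intro hθ
      obtain ⟨q, hq, hθq⟩ := eq_twistedBox_of_mem K M D hn hK hθ
      exact ⟨q, hq, hθq.symm⟩
    · rintro ⟨q, hq, rfl⟩
      exact twistedBox_mem K M D hn hq
  have hQfin : {q : ℤ | 4 * |q| < (n : ℤ) + 1}
      = ↑(Finset.Icc (-((n / 4 : ℕ) : ℤ)) ((n / 4 : ℕ) : ℤ)) := by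
    ext q
    rw [Set.mem_setOf_eq, Finset.mem_coe, mem_windingWindow_iff]
  rw [himage, (twistedBox_injOn (by omega)).ncard_image, hQfin, Set.ncard_coe_finset,
    card_windingWindow]

/-! ### §4. The census WITH Cor. 1: every one of them is a STABLE synchronous state; Cor. 4 for
`N ≤ 4` -/

/-- Normal operation on the ring edges in the `(i, j)`-form of `NormalOperationStability`: positive
cosine on every edge `(k, ρk)` gives positive cosine on every coupled pair.
[cite: ManikTimmeWitthaut2017, §3 Cor. 1 («cos(θ*ᵢ − θ*ⱼ) > 0 holds for all edges»)] -/
theorem ring_normalOperation_of_edges {θ : Fin (n + 1) → ℝ}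
    (hno : ∀ k, 0 < Real.cos (θ k - θ (finRotate (n + 1) k))) :
    ∀ i j, i ≠ j → 0 < (ringSystem n K M D).C i j → 0 < Real.cos (θ i - θ j) := by
  intro i j _ hC
  simp only [ringSystem_C] at hC
  have hedge : j = finRotate (n + 1) i ∨ i = finRotate (n + 1) j := by
    by_contra h
    rw [if_neg h] at hC
    exact lt_irrefl _ hC
  rcases hedge with h | h
  · rw [h]; exact hno i
  · rw [h, ← Real.cos_neg, neg_sub]; exact hno j

/-- **Every pinned normal-operation synchronous state of the ring is a STABLE synchronous state of
the damped swing model** (`N ≥ 3`, `K > 0`, `Mᵢ, Dᵢ > 0`; Cor. 1 of `NormalOperationStability`, energy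
route, census-free): for every `ε > 0` there is `δ > 0` such that from every state within `δ` of
`(θ, 0)` a forward-global motion exists and EVERY one stays within `ε` of `(θ, 0)` and converges to the
rotated rest point of its own momentum leaf. «These states … are guaranteed to be stable by
corollary 1.» [cite: ManikTimmeWitthaut2017, §5.4 (p0012 L25–L33) and §3 Cor. 1] -/
theorem ring_normalOperation_stable (hn : 2 ≤ n) (hK : 0 < K) (hM : ∀ i, 0 < M i)
    (hD : ∀ i, 0 < D i) {θ : Fin (n + 1) → ℝ}
    (hflow : ∀ k, (ringSystem n K M D).flow θ k = 0)
    (hno : ∀ k, 0 < Real.cos (θ k - θ (finRotate (n + 1) k))) {ε : ℝ} (hε : 0 < ε) :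
    ∃ δ > 0, ∀ x₁ : (Fin (n + 1) → ℝ) × (Fin (n + 1) → ℝ), dist x₁ (θ, 0) < δ →
      (∃ X : ℝ → (Fin (n + 1) → ℝ) × (Fin (n + 1) → ℝ), X 0 = x₁ ∧
          ∀ T : ℝ, ∀ t ∈ Icc 0 T,
            HasDerivWithinAt X ((ringSystem n K M D).field (X t)) (Icc 0 T) t) ∧
        ∀ X : ℝ → (Fin (n + 1) → ℝ) × (Fin (n + 1) → ℝ), X 0 = x₁ →
          (∀ T : ℝ, ∀ t ∈ Icc 0 T,
            HasDerivWithinAt X ((ringSystem n K M D).field (X t)) (Icc 0 T) t) →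
          (∀ t, 0 ≤ t → dist (X t) (θ, 0) < ε) ∧
          Tendsto X atTop (𝓝 ((fun j => θ j +
            (∑ i, (M i * x₁.2 i + D i * (x₁.1 i - θ i))) / ∑ i, D i), 0)) := by
  have _ := hn
  have hsync : ∀ k, (ringSystem n K M D).P k
      - (ringSystem n K M D).D k * ((∑ j, (ringSystem n K M D).P j) / ∑ j, (ringSystem n K M D).D j)
      = (ringSystem n K M D).flow θ k := by
    intro k
    rw [hflow k]
    simp [ringSystem]
  have h := (ringSystem n K M D).stable_syncSolution_of_normalOperation (ringSystem_C_symm K M D)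
    (ringSystem_C_nonneg K M D hK.le) (ringSystem_couplingConnected K M D hK) hM hD hsync
    (ring_normalOperation_of_edges K M D hno) hε
  have hP : (∑ j, (ringSystem n K M D).P j) / (∑ j, (ringSystem n K M D).D j) = 0 := by
    simp [ringSystem]
  simp only [hP, zero_mul, sub_zero, Prod.mk.eta] at h
  obtain ⟨δ, hδ, hst⟩ := h
  refine ⟨δ, hδ, fun x₁ hx₁ => ?_⟩
  have hx₁' : dist x₁ (θ, fun _ : Fin (n + 1) => (0 : ℝ)) < δ := hx₁
  obtain ⟨hex, hall⟩ := hst x₁ hx₁'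
  refine ⟨hex, fun X hX0 hX => ?_⟩
  obtain ⟨hstay, htend⟩ := hall X hX0 hX
  refine ⟨fun t ht => hstay t ht, ?_⟩
  simpa [ringSystem] using htend

/-- ★★ **THE CENSUS OF THE RING WITH STABILITY (Thm 12 for `P ≡ 0` + Cor. 1)**: on the homogeneous
unloaded ring of `N = n + 1 ≥ 3` machines (`K > 0`, `Mᵢ, Dᵢ > 0`) the pinned normal-operation
synchronous states of the period box number EXACTLY `2⌊n/4⌋ + 1 = 2⌈N/4⌉ − 1`, each of them IS a
`q`-twisted state with `4|q| < N` modulo whole turns of single machines, and EVERY one of them is a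
STABLE synchronous state of the damped swing model (nearby motions stay nearby and converge to the
rotated rest point of their leaf). THREE COLUMNS: CERTIFIED for MODEL `M` = damped swing model on the
homogeneous unloaded ring (MV-1 class, an idealised ring); «stable» = synchronous states of MODEL
`M`, never a grid; the number counts normal-operation states only.
[cite: ManikTimmeWitthaut2017, §5.4 Thm 12 and Cor. 4, §3 Cor. 1; MiharaEtAl2022, §I; WileyStrogatzGirvan2006, (q-twisted states)] -/
theorem ring_normalOperation_census (hn : 2 ≤ n) (hK : 0 < K) (hM : ∀ i, 0 < M i)
    (hD : ∀ i, 0 < D i) :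
    {θ : Fin (n + 1) → ℝ | θ 0 = 0 ∧ (∀ i, θ i ∈ Set.Ico (-π) π) ∧
        (∀ k, (ringSystem n K M D).flow θ k = 0) ∧
        ∀ k, 0 < Real.cos (θ k - θ (finRotate (n + 1) k))}.ncard = 2 * (n / 4) + 1 ∧
    ∀ θ ∈ {θ : Fin (n + 1) → ℝ | θ 0 = 0 ∧ (∀ i, θ i ∈ Set.Ico (-π) π) ∧
        (∀ k, (ringSystem n K M D).flow θ k = 0) ∧
        ∀ k, 0 < Real.cos (θ k - θ (finRotate (n + 1) k))},
      (∃ q : ℤ, 4 * |q| < (n : ℤ) + 1 ∧ ∀ j, ∃ mj : ℤ, θ j = twistedState n q j + mj * (2 * π)) ∧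
      ∀ ε > 0, ∃ δ > 0, ∀ x₁ : (Fin (n + 1) → ℝ) × (Fin (n + 1) → ℝ), dist x₁ (θ, 0) < δ →
        (∃ X : ℝ → (Fin (n + 1) → ℝ) × (Fin (n + 1) → ℝ), X 0 = x₁ ∧
            ∀ T : ℝ, ∀ t ∈ Icc 0 T,
              HasDerivWithinAt X ((ringSystem n K M D).field (X t)) (Icc 0 T) t) ∧
          ∀ X : ℝ → (Fin (n + 1) → ℝ) × (Fin (n + 1) → ℝ), X 0 = x₁ →
            (∀ T : ℝ, ∀ t ∈ Icc 0 T,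
              HasDerivWithinAt X ((ringSystem n K M D).field (X t)) (Icc 0 T) t) →
            (∀ t, 0 ≤ t → dist (X t) (θ, 0) < ε) ∧
            Tendsto X atTop (𝓝 ((fun j => θ j +
              (∑ i, (M i * x₁.2 i + D i * (x₁.1 i - θ i))) / ∑ i, D i), 0)) := by
  refine ⟨ncard_ring_normalOperation_syncStates K M D hn hK, ?_⟩
  rintro θ ⟨h0, hbox, hflow, hno⟩
  refine ⟨?_, fun ε hε => ring_normalOperation_stable K M D hn hK hM hD hflow hno hε⟩
  obtain ⟨q, hq, hj⟩ := exists_winding_of_normalOperation K M D hn hK hflow hno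
  refine ⟨q, hq, fun j => ?_⟩
  obtain ⟨mj, hmj⟩ := hj j
  exact ⟨mj, by rw [hmj, h0, zero_add]⟩

/-- **Corollary 4 for the unloaded ring: `N ≤ 4` machines ⇒ NO multistability** — exactly ONE
pinned normal-operation synchronous state per period (the in-phase state `θ = 0`).
[cite: ManikTimmeWitthaut2017, §5.4 Cor. 4 («In particular, ring networks R_N with N ≤ 4 do not have multiple stable fixed points»)] -/
theorem ring_no_multistability_of_le_four (hn : 2 ≤ n) (hn4 : n + 1 ≤ 4) (hK : 0 < K) :
    {θ : Fin (n + 1) → ℝ | θ 0 = 0 ∧ (∀ i, θ i ∈ Set.Ico (-π) π) ∧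
        (∀ k, (ringSystem n K M D).flow θ k = 0) ∧
        ∀ k, 0 < Real.cos (θ k - θ (finRotate (n + 1) k))}.ncard = 1 := by
  rw [ncard_ring_normalOperation_syncStates K M D hn hK]
  have : n / 4 = 0 := by omega
  rw [this]

end Ring

end ClassicalModel

end Literature.MathematicalPhysics.PowerSystems

end
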